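import Summits.QuantumFields.YangMills.Theorems.BalabanUVNodesN15TwoGridTwistedJetPiece
import Summits.QuantumFields.YangMills.Theorems.BalabanUVNodesN15TwoGridGluingGradientGeneralTransport
import HarnessLib

/-!
# N15 = NE2, road (c) — PROGRAMME (PC), (PC-E-J): ★★★★ THE TWO-GRID η-DEFECT OF THE GRADIENT ENTRY `D∘𝒢` OF THE GLUED PROPAGATOR, EACH CUBE IN ITS OWN GAUGE PAIR, THROUGH THE
# TWISTED TRANSPORT — n15-c∕333 §4 `hasMaj_idef_glued_of_localGauges_tr` WITH A COVARIANT-DERIVATIVE LEFT FACTOR: n15-c∕399's generic jet glue fed by 333's piece conversions, the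
# one-grid jet rows moved through the gauge law (n15-c∕400) and the per-piece jet conversion n15-c∕401 (dag-n15-c g35, n15-c∕402)

Cell `pub-ymgap`, seat `pub-ymgap-dag-n15-c` (generation g35; R134 (a) seat, strategy s1 «first missing estimate»; HUMAN RULING D-0062; chair R424 venue).
`bears_on: R4∕N15 · K3⁸ SpineGivenEndpointR13SepCoPHV (stmt-QuantumFields-27366)`; filed `--kind proof --supports stmt-QuantumFields-27366 --as helper` — COUNT-NEUTRAL.
THREE theorems, 0 `def`, 0 `sorry`; bookkeeping over landed rows.  Imports BY NAME n15-c∕401 `…TwoGridTwistedJetPiece` (`hasMaj_idef_conj_covD_tr`; through it n15-c∕400 `covD_comp_conj_eq`,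
n15-c∕333 `…CurvedGluingLocalGaugesTwoGridTwisted` (`cutDefect∕commDefect∕defectDefect_of_localGauge_tr`, `hasMaj_idef_mulOp_tr`), dag-n15-w2 `…CurvedGluingLocalGauges` (`cutRow∕commRow∕
defectRow_of_localGauge`), `…CubeDressedGeneralGauge` (`mulOp_comp_gaugeConj`, `hasMaj_gaugeConj_back`)) and n15-c∕399 `…TwoGridGluingGradientGeneralTransport` (★★★
`hasMaj_idef_comp_glued_of_cutRows_defect_tr`).  Nothing in the tree is modified, no landed name re-declared.

WHY (PCJ-DESIGN-g35.md §2, the «53∕335 level» row, generic half).  This is the gauged, twisted two-grid glue for the GRADIENT entry: what remains for the successor's cube-level file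
(334J) is to PRODUCE the displayed inner-jet rows `hJc∕hJc′` (n15-c∕400 `hasMaj_covD_comp_of_rows` on dag-n15-w3 34-jet), their flat defect `hDJ` (n15-c∕400 `hasMaj_idef_covD_comp_loc_gtr`
on dag-n15-w3 35-jet + shift + coefficient defects) and the output plateau `hJout` for the (PC) dressed cubes, exactly as n15-c∕334 produces `hGc∕hDGc∕hGout` for n15-c∕333.

CONTENTS.
* §1 `jetRow_of_localGauge` — the one-grid row of `D_R∘(χ·M_{Wᵀ}G′M_W)` from the INNER jet row `D_{R^W}∘(χG′) ≤ 1_S1_Sβ₁e^{−δd}`: `≤ 1_S1_S·|κ|²β₁·e^{−δd}` (gauge law + conjugation).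
* §2 `jetDefect_of_localGauge_tr` — the twisted two-grid defect of the gradient cut pieces from the inner jet pieces' rows `β₁′, β₁`, flat defect `m_D`, supports, smeared stair letters:
  `≤ 1_S1_S·|κ|²(m_D + sβ₁′ + sβ₁)·e^{−δd}` (n15-c∕401 after `mulOp_comp_gaugeConj`).
* §3 ★★★★ `hasMaj_idef_comp_glued_of_localGauges_tr` — 333 §4 with `D′∘`, `D∘` in front: 333's hypotheses VERBATIM + the Leibniz rules `D∘M_{h_□} = M_{h^s_□}∘D + M_{dh_□}` on both
  grids, the letters∕fits of `h^s`, `dh`, the inner jet rows∕defects∕output plateaux ⟹ n15-c∕399's conclusion at the letters `β ↦ |κ|²β, β₁ ↦ |κ|²β₁, θ₀ ↦ |κ|²θ₀, ε ↦ |κ|²ε,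
  m₀ ↦ |κ|²(m + 2sβ), m₁ ↦ |κ|²(m_D + sβ₁′… )` — see the statement.

HONEST FRAMING ∕ LIMITS.  Generic bookkeeping over abstract block geometries; the cube rows are HYPOTHESES; nothing of [B9] asserted.  NE2⁺ NOT PRINTED ∕ NOT proved; N15 of record
untouched (DISCHARGED AS CONSUMED, p687738); K3⁸ OPEN; counts of record UNMOVED (typed 28∕28 · discharged 8∕27); one finite 𝕋⁴ at fixed ε per index — NOT infinite volume, NOT OS on ℝ⁴, NOT a
mass gap, NOT Clay.  Restate-immune (no Theses import).
-/

noncomputable section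
open scoped BigOperators Matrix
open Finset

namespace Summit.QuantumFields.YangMills.BalabanUVNodes.N15.Gluing

open Literature.MathematicalPhysics.QuantumFieldTheory.Balaban1983to89
open Literature.MathematicalPhysics.QuantumFieldTheory.Balaban1983to89.B11SectG (BlockNorm HasMaj RowSum)
open Literature.MathematicalPhysics.QuantumFieldTheory.Balaban1983to89.B6RandomWalk (Triangle254)
open Literature.MathematicalPhysics.QuantumFieldTheory.Balaban1983to89.T4EtaRateDefect (idef idef_comp idef_add idef_sub)
open Literature.MathematicalPhysics.QuantumFieldTheory.Balaban1983to89.T4EtaRateCoeffDefect (pull pull_apply diagK diagK_nonneg)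
open Literature.MathematicalPhysics.QuantumFieldTheory.Balaban1983to89.B6Prop26Gluing (mulOp mulOp_apply ind ind_nonneg ind_le_one)
open Summit.QuantumFields.YangMills.BalabanUVNodes.N15.MatrixSpecies (mmulOp mmulOp_apply liftBlk liftMap liftEquiv covD)
open Summit.QuantumFields.YangMills.BalabanUVNodes.N15.CurvedSpecies (hasMaj_idef_conj_tr cutDefect_of_localGauge_tr commDefect_of_localGauge_tr defectDefect_of_localGauge_tr
  hasMaj_idef_mulOp_tr cutRow_of_localGauge commRow_of_localGauge defectRow_of_localGauge mulOp_comp_gaugeConj hasMaj_gaugeConj_back)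

/-! ## §1 The one-grid jet row of a gauged cut piece -/

section JetRow

variable {X κ K : Type} [Fintype X] [DecidableEq X] [Fintype κ] [DecidableEq κ] {g : B6.Geometry} (blk : X → g.Site) (S : K → Set g.Site) (W : K → X → Matrix κ κ ℝ)
  {G' : K → (X × κ → ℝ) →ₗ[ℝ] (X × κ → ℝ)} {χX : K → X → ℝ}

omit [DecidableEq X] in
/-- ★ **JET ROWS TRANSFER**: the inner jet row `D_{R^W}∘(χG′) ≤ 1_S1_S·β₁e^{−δd}` in the cube's gauge (`R^W(x) = W(x)R(x)W(ex)ᵀ`) ⟹ `D_R∘(χ·M_{Wᵀ}G′M_W) ≤ 1_S1_S·|κ|²β₁·e^{−δd}` for the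
GLOBAL operator (gauge law n15-c∕400 + conjugation). [cite: Balaban1985BackgroundPropagators, (3.34)–(3.35) p.396, (3.42) p.397, (3.50) p.400 (shapes)] -/
theorem jetRow_of_localGauge (hW : ∀ k x, W k x * (W k x)ᵀ = 1) (hW' : ∀ k x, (W k x)ᵀ * W k x = 1) (η : ℝ) (R : X → Matrix κ κ ℝ) (e : X → X) {β₁ δ : ℝ} (hβ₁ : 0 ≤ β₁) (k : K)
    (hJc : HasMaj (BlockNorm.ofBlocks g (liftBlk blk κ)) (BlockNorm.ofBlocks g (liftBlk blk κ)) (covD η (fun x => W k x * R x * (W k (e x))ᵀ) e ∘ₗ (mulOp (fun p : X × κ => χX k p.1) ∘ₗ G' k))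
      (fun y y' => ind (S k) y * ind (S k) y' * (β₁ * Real.exp (-(δ * g.dist y y'))))) :
    HasMaj (BlockNorm.ofBlocks g (liftBlk blk κ)) (BlockNorm.ofBlocks g (liftBlk blk κ))
      (covD η R e ∘ₗ (mulOp (fun p : X × κ => χX k p.1) ∘ₗ (mmulOp (fun x => (W k x)ᵀ) ∘ₗ G' k ∘ₗ mmulOp (W k))))
      (fun y y' => ind (S k) y * ind (S k) y' * ((Fintype.card κ : ℝ) ^ 2 * β₁ * Real.exp (-(δ * g.dist y y')))) := by
  have e1 := mulOp_comp_gaugeConj (fun x => (W k x)ᵀ) (χX k) (G' k)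
  simp only [Matrix.transpose_transpose] at e1
  rw [show (fun x => W k x) = W k from rfl] at e1
  rw [e1, covD_comp_conj_eq (hW' k) η R e (mulOp (fun p : X × κ => χX k p.1) ∘ₗ G' k) (mmulOp (W k))]
  refine (hasMaj_gaugeConj_back blk (W k) (hW k) (hW' k) (fun y y' => ?_) hJc).mono fun y y' => le_of_eq (by ring)
  exact mul_nonneg (mul_nonneg (ind_nonneg _ y) (ind_nonneg _ y')) (mul_nonneg hβ₁ (Real.exp_nonneg _))

end JetRow

/-! ## §2 The twisted two-grid defect of the gradient cut pieces -/

section JetDefect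

variable {X X' κ K : Type} [Fintype X] [Fintype X'] [DecidableEq X] [DecidableEq X'] [Fintype κ] [DecidableEq κ] [Fintype K] {g : B6.Geometry}
  (blk : X → g.Site) (π : X' → X) (sec : X → X') (S : K → Set g.Site) (T : (X × κ → ℝ) →ₗ[ℝ] (X' × κ → ℝ)) (W' St : K → X' → Matrix κ κ ℝ)
  {G' : K → (X × κ → ℝ) →ₗ[ℝ] (X × κ → ℝ)} {G'' : K → (X' × κ → ℝ) →ₗ[ℝ] (X' × κ → ℝ)} {χX ψJ : K → X → ℝ} {χX' ψin' : K → X' → ℝ}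

omit [DecidableEq X] [DecidableEq X'] [Fintype K] in
/-- ★★ **GRADIENT CUT-PIECE DEFECTS, TWISTED**: raw transporters `R′`∕`R` (shifts `e′`∕`e`), cube gauges `W′_k` (fine) ∕ `W′_k∘σ` (coarse); inner jet pieces `D′_{R′^{W′}}∘(χ′G″)` with row `β₁′`,
`D_{R^{W′σ}}∘(χG′)` with row `β₁` and output plateau `ψ_J`; their FLAT defect `≤ 1_S1_S m_De^{−δd}`; fine input support `ψ′_in`; smeared stair letters `s` ⟹
`𝔇_T(D′_{R′}∘(χ′·M_{W′ᵀ}G″M_{W′}), D_R∘(χ·M_{(W′σ)ᵀ}G′M_{W′σ})) ≤ 1_S1_S·|κ|²(m_D + sβ₁′ + sβ₁)·e^{−δd}` (n15-c∕401 after `mulOp_comp_gaugeConj`).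
[cite: Balaban1985BackgroundPropagators, (3.34)–(3.35) p.396, (3.42) p.397, (3.50) p.400, Thm 3.14 pp.426–427 (template); Balaban1984PropagatorsII, (2.133)–(2.136) p.247] -/
theorem jetDefect_of_localGauge_tr (hW'1 : ∀ k v, (W' k v)ᵀ * W' k v = 1) (hW'2 : ∀ k v, W' k v * (W' k v)ᵀ = 1)
    (η η' : ℝ) (R : X → Matrix κ κ ℝ) (R' : X' → Matrix κ κ ℝ) (e : X → X) (e' : X' → X') {β₁ β₁' mD s δ : ℝ} (hβ₁ : 0 ≤ β₁) (hβ₁' : 0 ≤ β₁') (hmD : 0 ≤ mD) (hs : 0 ≤ s) (k : K)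
    (hTk : T = mmulOp (fun x' => (W' k x')ᵀ) ∘ₗ (mmulOp (fun x' => (St k x')ᵀ) ∘ₗ pull (liftMap π κ)) ∘ₗ mmulOp (fun x => W' k (sec x)))
    (hGin' : G'' k ∘ₗ mulOp (fun p : X' × κ => ψin' k p.1) = G'' k)
    (hJout : mulOp (fun p : X × κ => ψJ k p.1) ∘ₗ (covD η (fun x => W' k (sec x) * R x * (W' k (sec (e x)))ᵀ) e ∘ₗ (mulOp (fun p : X × κ => χX k p.1) ∘ₗ G' k)) =
      covD η (fun x => W' k (sec x) * R x * (W' k (sec (e x)))ᵀ) e ∘ₗ (mulOp (fun p : X × κ => χX k p.1) ∘ₗ G' k))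
    (hSin : ∀ x' i, ∑ j, |(ψin' k x' • ((St k x')ᵀ - 1)) i j| ≤ s) (hSout : ∀ x' i, ∑ j, |(ψJ k (π x') • ((St k x')ᵀ - 1)) i j| ≤ s)
    (hJc : HasMaj (BlockNorm.ofBlocks g (liftBlk blk κ)) (BlockNorm.ofBlocks g (liftBlk blk κ)) (covD η (fun x => W' k (sec x) * R x * (W' k (sec (e x)))ᵀ) e ∘ₗ (mulOp (fun p : X × κ => χX k p.1) ∘ₗ G' k))
      (fun y y' => ind (S k) y * ind (S k) y' * (β₁ * Real.exp (-(δ * g.dist y y')))))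
    (hJc' : HasMaj (BlockNorm.ofBlocks g (liftBlk (blk ∘ π) κ)) (BlockNorm.ofBlocks g (liftBlk (blk ∘ π) κ)) (covD η' (fun x' => W' k x' * R' x' * (W' k (e' x'))ᵀ) e' ∘ₗ (mulOp (fun p : X' × κ => χX' k p.1) ∘ₗ G'' k))
      (fun y y' => ind (S k) y * ind (S k) y' * (β₁' * Real.exp (-(δ * g.dist y y')))))
    (hDJ : HasMaj (BlockNorm.ofBlocks g (liftBlk blk κ)) (BlockNorm.ofBlocks g (liftBlk (blk ∘ π) κ))
      (idef (pull (liftMap π κ)) (pull (liftMap π κ)) (covD η' (fun x' => W' k x' * R' x' * (W' k (e' x'))ᵀ) e' ∘ₗ (mulOp (fun p : X' × κ => χX' k p.1) ∘ₗ G'' k))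
        (covD η (fun x => W' k (sec x) * R x * (W' k (sec (e x)))ᵀ) e ∘ₗ (mulOp (fun p : X × κ => χX k p.1) ∘ₗ G' k)))
      (fun y y' => ind (S k) y * ind (S k) y' * (mD * Real.exp (-(δ * g.dist y y'))))) :
    HasMaj (BlockNorm.ofBlocks g (liftBlk blk κ)) (BlockNorm.ofBlocks g (liftBlk (blk ∘ π) κ))
      (idef T T (covD η' R' e' ∘ₗ (mulOp (fun p : X' × κ => χX' k p.1) ∘ₗ (mmulOp (fun x' => (W' k x')ᵀ) ∘ₗ G'' k ∘ₗ mmulOp (W' k))))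
        (covD η R e ∘ₗ (mulOp (fun p : X × κ => χX k p.1) ∘ₗ (mmulOp (fun x => (W' k (sec x))ᵀ) ∘ₗ G' k ∘ₗ mmulOp (fun x => W' k (sec x))))))
      (fun y y' => ind (S k) y * ind (S k) y' * ((Fintype.card κ : ℝ) ^ 2 * (mD + s * β₁' + s * β₁) * Real.exp (-(δ * g.dist y y')))) := by
  have e1 := mulOp_comp_gaugeConj (fun x => (W' k (sec x))ᵀ) (χX k) (G' k)
  have e1' := mulOp_comp_gaugeConj (fun x' => (W' k x')ᵀ) (χX' k) (G'' k)
  simp only [Matrix.transpose_transpose] at e1 e1'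
  rw [show (fun x' => W' k x') = W' k from rfl] at e1'
  rw [e1, e1']
  have hXin : (mulOp (fun p : X' × κ => χX' k p.1) ∘ₗ G'' k) ∘ₗ mulOp (fun p : X' × κ => ψin' k p.1) = mulOp (fun p : X' × κ => χX' k p.1) ∘ₗ G'' k := by
    rw [LinearMap.comp_assoc, hGin']
  have hE : ∀ y y' : g.Site, 0 ≤ Real.exp (-(δ * g.dist y y')) := fun _ _ => Real.exp_nonneg _
  have h := hasMaj_idef_conj_covD_tr blk π sec T (W' k) (St k) (hW'1 k) (hW'2 k) hTk η η' R R' e e' hs hXin hJout hSin hSout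
    (fun a b => mul_nonneg (mul_nonneg (ind_nonneg _ a) (ind_nonneg _ b)) (mul_nonneg hβ₁' (hE a b)))
    (fun a b => mul_nonneg (mul_nonneg (ind_nonneg _ a) (ind_nonneg _ b)) (mul_nonneg hβ₁ (hE a b)))
    (fun a b => mul_nonneg (mul_nonneg (ind_nonneg _ a) (ind_nonneg _ b)) (mul_nonneg hmD (hE a b))) hJc' hJc hDJ
  exact h.mono fun y y' => le_of_eq (by ring)

end JetDefect

/-! ## §3 The gradient entry of the glued propagator in per-cube gauges through the twisted transport -/

section Glue

variable {X X' κ K : Type} [Fintype X] [Fintype X'] [DecidableEq X] [DecidableEq X'] [Fintype κ] [DecidableEq κ] [Fintype K] {g : B6.Geometry}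
  (blk : X → g.Site) (π : X' → X) (sec : X → X') (S : K → Set g.Site) {σ cr : ℝ} (T : (X × κ → ℝ) →ₗ[ℝ] (X' × κ → ℝ)) (W' St : K → X' → Matrix κ κ ℝ) (Ψ : X' → Matrix κ κ ℝ)
  {Δ : (X × κ → ℝ) →ₗ[ℝ] (X × κ → ℝ)} {Δ' : (X' × κ → ℝ) →ₗ[ℝ] (X' × κ → ℝ)} {G' E' : K → (X × κ → ℝ) →ₗ[ℝ] (X × κ → ℝ)}
  {G'' E'' : K → (X' × κ → ℝ) →ₗ[ℝ] (X' × κ → ℝ)} {χX hX hsX dhX ψout ψJ : K → X → ℝ} {χX' hX' hsX' dhX' ψin' : K → X' → ℝ}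

/-- ★★★★ **THE TWO-GRID η-DEFECT OF THE GRADIENT ENTRY OF THE GLUED PROPAGATOR, EACH CUBE IN ITS OWN GAUGE PAIR, THROUGH THE TWISTED TRANSPORT** — n15-c∕333 §4 with the covariant
derivatives `D′ = covD η′ R′ e′`, `D = covD η R e` of the RAW fields in front: 333's hypotheses VERBATIM, plus the Leibniz rules through the partition on both grids, the letters `c_s, c_d`
and flat fits `o_s, o_d` of `h^s, dh`, and — per cube, IN THE CUBE's GAUGES — the inner jet rows `β₁` (coarse, output plateau `ψ_J`) ∕ `β₁′` (fine) and their flat defect `m_D`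
⟹ n15-c∕399's conclusion at the transferred letters. [cite: Balaban1984PropagatorsII, (2.91) p.239, (2.133)–(2.136) p.247 (mechanism); Balaban1985BackgroundPropagators, (3.34)–(3.35) p.396, (3.42) p.397 (gradient entry), (3.50) p.400,
(3.87)–(3.90) pp.409–410, Thm 3.14 pp.426–427 (difference template); King1986, Prop. 3.9 (3.73) p.665 (η-rate shape), p.664 (pairing)] -/
theorem hasMaj_idef_comp_glued_of_localGauges_tr (htri : Triangle254 g) (hd : ∀ a b : g.Site, 0 ≤ g.dist a b) (hd0 : ∀ y : g.Site, g.dist y y = 0) (hrow : RowSum g σ cr)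
    (hσ : 0 ≤ σ) (hcr : 0 ≤ cr) (hW'1 : ∀ k v, (W' k v)ᵀ * W' k v = 1) (hW'2 : ∀ k v, W' k v * (W' k v)ᵀ = 1)
    (η η' : ℝ) (R : X → Matrix κ κ ℝ) (R' : X' → Matrix κ κ ℝ) (e : X → X) (e' : X' → X')
    {β β₁ cs cd θ₀ ε m mD r rE o os od δ Nov s : ℝ} (hβ : 0 ≤ β) (hβ₁ : 0 ≤ β₁) (hcs : 0 ≤ cs) (hcd : 0 ≤ cd) (hθ : 0 ≤ θ₀) (hε : 0 ≤ ε) (hm : 0 ≤ m)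
    (hmD : 0 ≤ mD) (hr : 0 ≤ r) (hrE : 0 ≤ rE) (ho : 0 ≤ o) (hos : 0 ≤ os) (hod : 0 ≤ od) (hs : 0 ≤ s) (hNov : 0 ≤ Nov) (hσδ : 2 * σ ≤ δ)
    -- Leibniz through the partition, both grids; cuts; letters and flat fits of `h`, `h^s`, `dh`
    (hleib : ∀ k, covD η R e ∘ₗ mulOp (fun p : X × κ => hX k p.1) = mulOp (fun p : X × κ => hsX k p.1) ∘ₗ covD η R e + mulOp (fun p : X × κ => dhX k p.1))
    (hleib' : ∀ k, covD η' R' e' ∘ₗ mulOp (fun p : X' × κ => hX' k p.1) = mulOp (fun p : X' × κ => hsX' k p.1) ∘ₗ covD η' R' e' + mulOp (fun p : X' × κ => dhX' k p.1))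
    (hcut : ∀ k, mulOp (fun p : X × κ => hX k p.1) ∘ₗ mulOp (fun p : X × κ => χX k p.1) = mulOp (fun p : X × κ => hX k p.1))
    (hcut' : ∀ k, mulOp (fun p : X' × κ => hX' k p.1) ∘ₗ mulOp (fun p : X' × κ => χX' k p.1) = mulOp (fun p : X' × κ => hX' k p.1))
    (hh : ∀ k p, |(fun p : X × κ => hX k p.1) p| ≤ 1) (hh' : ∀ k p, |(fun p : X' × κ => hX' k p.1) p| ≤ 1)
    (hhs' : ∀ k p, |(fun p : X' × κ => hsX' k p.1) p| ≤ cs) (hdh' : ∀ k p, |(fun p : X' × κ => dhX' k p.1) p| ≤ cd)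
    (hfit : ∀ k p, |(fun p : X' × κ => hX' k p.1) p - (fun p : X × κ => hX k p.1) (liftMap π κ p)| ≤ o)
    (hfits : ∀ k p, |(fun p : X' × κ => hsX' k p.1) p - (fun p : X × κ => hsX k p.1) (liftMap π κ p)| ≤ os)
    (hfitd : ∀ k p, |(fun p : X' × κ => dhX' k p.1) p - (fun p : X × κ => dhX k p.1) (liftMap π κ p)| ≤ od)
    (hN : ∀ a, ∑ k, ind (S k) a ≤ Nov)
    -- the transport (as in n15-c∕333)
    (hTk : ∀ k, T = mmulOp (fun x' => (W' k x')ᵀ) ∘ₗ (mmulOp (fun x' => (St k x')ᵀ) ∘ₗ pull (liftMap π κ)) ∘ₗ mmulOp (fun x => W' k (sec x)))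
    (hT0 : T = mmulOp (fun x' => (Ψ x')ᵀ) ∘ₗ pull (liftMap π κ)) (hΨ : ∀ x' i j, |(Ψ x')ᵀ i j| ≤ 1)
    -- supports of the pieces and the smeared stair letters (as in n15-c∕333, plus the output plateau `ψ_J` of the inner jet pieces)
    (hGin' : ∀ k, G'' k ∘ₗ mulOp (fun p : X' × κ => ψin' k p.1) = G'' k) (hEin' : ∀ k, E'' k ∘ₗ mulOp (fun p : X' × κ => ψin' k p.1) = E'' k)
    (hGout : ∀ k, mulOp (fun p : X × κ => ψout k p.1) ∘ₗ (mulOp (fun p : X × κ => χX k p.1) ∘ₗ G' k) = mulOp (fun p : X × κ => χX k p.1) ∘ₗ G' k)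
    (hKout : ∀ k, mulOp (fun p : X × κ => ψout k p.1) ∘ₗ (commOp (mmulOp (fun x => W' k (sec x)) ∘ₗ Δ ∘ₗ mmulOp (fun x => (W' k (sec x))ᵀ)) (fun p : X × κ => hX k p.1) ∘ₗ G' k) =
      commOp (mmulOp (fun x => W' k (sec x)) ∘ₗ Δ ∘ₗ mmulOp (fun x => (W' k (sec x))ᵀ)) (fun p : X × κ => hX k p.1) ∘ₗ G' k)
    (hEout : ∀ k, mulOp (fun p : X × κ => ψout k p.1) ∘ₗ E' k = E' k)
    (hJout : ∀ k, mulOp (fun p : X × κ => ψJ k p.1) ∘ₗ (covD η (fun x => W' k (sec x) * R x * (W' k (sec (e x)))ᵀ) e ∘ₗ (mulOp (fun p : X × κ => χX k p.1) ∘ₗ G' k)) =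
      covD η (fun x => W' k (sec x) * R x * (W' k (sec (e x)))ᵀ) e ∘ₗ (mulOp (fun p : X × κ => χX k p.1) ∘ₗ G' k))
    (hSin : ∀ k x' i, ∑ j, |(ψin' k x' • ((St k x')ᵀ - 1)) i j| ≤ s) (hSout : ∀ k x' i, ∑ j, |(ψout k (π x') • ((St k x')ᵀ - 1)) i j| ≤ s)
    (hSoutJ : ∀ k x' i, ∑ j, |(ψJ k (π x') • ((St k x')ᵀ - 1)) i j| ≤ s)
    -- rows in the cubes' gauges, both grids (as in n15-c∕333) + the inner jet rows
    (hGc : ∀ k, HasMaj (BlockNorm.ofBlocks g (liftBlk blk κ)) (BlockNorm.ofBlocks g (liftBlk blk κ)) (mulOp (fun p : X × κ => χX k p.1) ∘ₗ G' k)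
      (fun y y' => ind (S k) y * ind (S k) y' * (β * Real.exp (-(δ * g.dist y y')))))
    (hGc' : ∀ k, HasMaj (BlockNorm.ofBlocks g (liftBlk (blk ∘ π) κ)) (BlockNorm.ofBlocks g (liftBlk (blk ∘ π) κ)) (mulOp (fun p : X' × κ => χX' k p.1) ∘ₗ G'' k)
      (fun y y' => ind (S k) y * ind (S k) y' * (β * Real.exp (-(δ * g.dist y y')))))
    (hJc : ∀ k, HasMaj (BlockNorm.ofBlocks g (liftBlk blk κ)) (BlockNorm.ofBlocks g (liftBlk blk κ)) (covD η (fun x => W' k (sec x) * R x * (W' k (sec (e x)))ᵀ) e ∘ₗ (mulOp (fun p : X × κ => χX k p.1) ∘ₗ G' k))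
      (fun y y' => ind (S k) y * ind (S k) y' * (β₁ * Real.exp (-(δ * g.dist y y')))))
    (hJc' : ∀ k, HasMaj (BlockNorm.ofBlocks g (liftBlk (blk ∘ π) κ)) (BlockNorm.ofBlocks g (liftBlk (blk ∘ π) κ))
      (covD η' (fun x' => W' k x' * R' x' * (W' k (e' x'))ᵀ) e' ∘ₗ (mulOp (fun p : X' × κ => χX' k p.1) ∘ₗ G'' k))
      (fun y y' => ind (S k) y * ind (S k) y' * (β₁ * Real.exp (-(δ * g.dist y y')))))
    (hK : ∀ k, HasMaj (BlockNorm.ofBlocks g (liftBlk blk κ)) (BlockNorm.ofBlocks g (liftBlk blk κ))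
      (commOp (mmulOp (fun x => W' k (sec x)) ∘ₗ Δ ∘ₗ mmulOp (fun x => (W' k (sec x))ᵀ)) (fun p : X × κ => hX k p.1) ∘ₗ G' k) (fun y y' => ind (S k) y' * (θ₀ * Real.exp (-(δ * g.dist y y')))))
    (hK' : ∀ k, HasMaj (BlockNorm.ofBlocks g (liftBlk (blk ∘ π) κ)) (BlockNorm.ofBlocks g (liftBlk (blk ∘ π) κ))
      (commOp (mmulOp (W' k) ∘ₗ Δ' ∘ₗ mmulOp (fun x' => (W' k x')ᵀ)) (fun p : X' × κ => hX' k p.1) ∘ₗ G'' k)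
      (fun y y' => ind (S k) y' * (θ₀ * Real.exp (-(δ * g.dist y y')))))
    (hE : ∀ k, HasMaj (BlockNorm.ofBlocks g (liftBlk blk κ)) (BlockNorm.ofBlocks g (liftBlk blk κ)) (E' k) (fun y y' => ind (S k) y * (ε * Real.exp (-(δ * g.dist y y')))))
    (hE' : ∀ k, HasMaj (BlockNorm.ofBlocks g (liftBlk (blk ∘ π) κ)) (BlockNorm.ofBlocks g (liftBlk (blk ∘ π) κ)) (E'' k) (fun y y' => ind (S k) y * (ε * Real.exp (-(δ * g.dist y y')))))
    -- η-defects in the cubes' gauges (as in n15-c∕333) + the flat defect of the inner jet pieces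
    (hDGc : ∀ k, HasMaj (BlockNorm.ofBlocks g (liftBlk blk κ)) (BlockNorm.ofBlocks g (liftBlk (blk ∘ π) κ))
      (idef (pull (liftMap π κ)) (pull (liftMap π κ)) (mulOp (fun p : X' × κ => χX' k p.1) ∘ₗ G'' k) (mulOp (fun p : X × κ => χX k p.1) ∘ₗ G' k))
      (fun y y' => ind (S k) y * ind (S k) y' * (m * Real.exp (-(δ * g.dist y y')))))
    (hDJ : ∀ k, HasMaj (BlockNorm.ofBlocks g (liftBlk blk κ)) (BlockNorm.ofBlocks g (liftBlk (blk ∘ π) κ))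
      (idef (pull (liftMap π κ)) (pull (liftMap π κ)) (covD η' (fun x' => W' k x' * R' x' * (W' k (e' x'))ᵀ) e' ∘ₗ (mulOp (fun p : X' × κ => χX' k p.1) ∘ₗ G'' k))
        (covD η (fun x => W' k (sec x) * R x * (W' k (sec (e x)))ᵀ) e ∘ₗ (mulOp (fun p : X × κ => χX k p.1) ∘ₗ G' k)))
      (fun y y' => ind (S k) y * ind (S k) y' * (mD * Real.exp (-(δ * g.dist y y')))))
    (hDK : ∀ k, HasMaj (BlockNorm.ofBlocks g (liftBlk blk κ)) (BlockNorm.ofBlocks g (liftBlk (blk ∘ π) κ))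
      (idef (pull (liftMap π κ)) (pull (liftMap π κ))
        (commOp (mmulOp (W' k) ∘ₗ Δ' ∘ₗ mmulOp (fun x' => (W' k x')ᵀ)) (fun p : X' × κ => hX' k p.1) ∘ₗ G'' k)
        (commOp (mmulOp (fun x => W' k (sec x)) ∘ₗ Δ ∘ₗ mmulOp (fun x => (W' k (sec x))ᵀ)) (fun p : X × κ => hX k p.1) ∘ₗ G' k))
      (fun y y' => ind (S k) y' * (r * Real.exp (-(δ * g.dist y y')))))
    (hDE : ∀ k, HasMaj (BlockNorm.ofBlocks g (liftBlk blk κ)) (BlockNorm.ofBlocks g (liftBlk (blk ∘ π) κ)) (idef (pull (liftMap π κ)) (pull (liftMap π κ)) (E'' k) (E' k))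
      (fun y y' => ind (S k) y * (rE * Real.exp (-(δ * g.dist y y')))))
    (hq : Nov * ((Fintype.card κ : ℝ) ^ 2 * θ₀ + (Fintype.card κ : ℝ) ^ 2 * ε) * cr < 1) :
    HasMaj (BlockNorm.ofBlocks g (liftBlk blk κ)) (BlockNorm.ofBlocks g (liftBlk (blk ∘ π) κ))
      (idef T T
        (covD η' R' e' ∘ₗ glueInv (parametrix (fun k => fun p : X' × κ => hX' k p.1) (fun k => mmulOp (fun x' => (W' k x')ᵀ) ∘ₗ G'' k ∘ₗ mmulOp (W' k)))
          (remainder Δ' (fun k => fun p : X' × κ => hX' k p.1) (fun k => mmulOp (fun x' => (W' k x')ᵀ) ∘ₗ G'' k ∘ₗ mmulOp (W' k)) -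
            ∑ k, (mmulOp (fun x' => (W' k x')ᵀ) ∘ₗ E'' k ∘ₗ mmulOp (W' k)) ∘ₗ mulOp (fun p : X' × κ => hX' k p.1)))
        (covD η R e ∘ₗ glueInv (parametrix (fun k => fun p : X × κ => hX k p.1) (fun k => mmulOp (fun x => (W' k (sec x))ᵀ) ∘ₗ G' k ∘ₗ mmulOp (fun x => W' k (sec x))))
          (remainder Δ (fun k => fun p : X × κ => hX k p.1) (fun k => mmulOp (fun x => (W' k (sec x))ᵀ) ∘ₗ G' k ∘ₗ mmulOp (fun x => W' k (sec x))) -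
            ∑ k, (mmulOp (fun x => (W' k (sec x))ᵀ) ∘ₗ E' k ∘ₗ mmulOp (fun x => W' k (sec x))) ∘ₗ mulOp (fun p : X × κ => hX k p.1))))
      (fun y y' => (Nov * (cs * ((Fintype.card κ : ℝ) ^ 2 * β₁) + cd * ((Fintype.card κ : ℝ) ^ 2 * β)) * ((1 - Nov * (((Fintype.card κ : ℝ) ^ 2 * θ₀) + ((Fintype.card κ : ℝ) ^ 2 * ε)) * cr)⁻¹ * ((1 - Nov * (((Fintype.card κ : ℝ) ^ 2 * θ₀) + ((Fintype.card κ : ℝ) ^ 2 * ε)) * cr)⁻¹ * (Nov * (((Fintype.card κ : ℝ) ^ 2 * θ₀) * ((Fintype.card κ : ℝ) * o) + ((Fintype.card κ : ℝ) ^ 2 * (r + s * θ₀ + s * θ₀)) + (((Fintype.card κ : ℝ) ^ 2 * ε) * ((Fintype.card κ : ℝ) * o) + ((Fintype.card κ : ℝ) ^ 2 * (rE + s * ε + s * ε))))) * cr) * cr) * cr +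
        Nov * ((cs * ((Fintype.card κ : ℝ) ^ 2 * β₁) * ((Fintype.card κ : ℝ) * o) + cs * ((Fintype.card κ : ℝ) ^ 2 * (mD + s * β₁ + s * β₁)) * 1 + ((Fintype.card κ : ℝ) * os) * ((Fintype.card κ : ℝ) ^ 2 * β₁) * 1) + (cd * ((Fintype.card κ : ℝ) ^ 2 * β) * ((Fintype.card κ : ℝ) * o) + cd * ((Fintype.card κ : ℝ) ^ 2 * (m + s * β + s * β)) * 1 + ((Fintype.card κ : ℝ) * od) * ((Fintype.card κ : ℝ) ^ 2 * β) * 1)) * (1 - Nov * (((Fintype.card κ : ℝ) ^ 2 * θ₀) + ((Fintype.card κ : ℝ) ^ 2 * ε)) * cr)⁻¹ * cr) * Real.exp (-((δ - 2 * σ) * g.dist y y'))) := by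
  exact hasMaj_idef_comp_glued_of_cutRows_defect_tr (liftBlk blk κ) (liftMap π κ) S T htri hd hd0 hrow hσ hcr (by positivity) (by positivity) hcs hcd (by positivity) (by positivity)
    (by positivity) (by positivity) (by positivity) (by positivity) (by positivity) (by positivity) (by positivity) hNov hσδ hleib hleib' hcut hcut' hh hh' hhs' hdh'
    (fun k => hasMaj_idef_mulOp_tr blk π T hT0 hΨ ho (hfit k)) (fun k => hasMaj_idef_mulOp_tr blk π T hT0 hΨ hos (hfits k)) (fun k => hasMaj_idef_mulOp_tr blk π T hT0 hΨ hod (hfitd k)) hN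
    (fun k => cutRow_of_localGauge blk S (fun k x => W' k (sec x)) χX G' (fun k x => hW'2 k (sec x)) (fun k x => hW'1 k (sec x)) hβ k (hGc k))
    (fun k => cutRow_of_localGauge (blk ∘ π) S W' χX' G'' hW'2 hW'1 hβ k (hGc' k))
    (fun k => jetRow_of_localGauge blk S (fun k x => W' k (sec x)) (fun k x => hW'2 k (sec x)) (fun k x => hW'1 k (sec x)) η R e hβ₁ k (hJc k))
    (fun k => jetRow_of_localGauge (blk ∘ π) S W' hW'2 hW'1 η' R' e' hβ₁ k (hJc' k))
    (fun k => cutDefect_of_localGauge_tr blk π sec S T W' St hW'1 hW'2 hβ hm hs k (hTk k) (hGin' k) (hGout k) (hSin k) (hSout k) (hGc k) (hGc' k) (hDGc k))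
    (fun k => jetDefect_of_localGauge_tr blk π sec S T W' St hW'1 hW'2 η η' R R' e e' hβ₁ hβ₁ hmD hs k (hTk k) (hGin' k) (hJout k) (hSin k) (hSoutJ k) (hJc k) (hJc' k) (hDJ k))
    (fun k => commRow_of_localGauge blk S (fun k x => W' k (sec x)) Δ hX G' (fun k x => hW'2 k (sec x)) (fun k x => hW'1 k (sec x)) hθ k (hK k))
    (fun k => commRow_of_localGauge (blk ∘ π) S W' Δ' hX' G'' hW'2 hW'1 hθ k (hK' k))
    (fun k => commDefect_of_localGauge_tr blk π sec S T W' St hW'1 hW'2 hθ hr hs k (hTk k) (hGin' k) (hKout k) (hSin k) (hSout k) (hK k) (hK' k) (hDK k))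
    (fun k => defectRow_of_localGauge blk S (fun k x => W' k (sec x)) E' (fun k x => hW'2 k (sec x)) (fun k x => hW'1 k (sec x)) hε k (hE k))
    (fun k => defectRow_of_localGauge (blk ∘ π) S W' E'' hW'2 hW'1 hε k (hE' k))
    (fun k => defectDefect_of_localGauge_tr blk π sec S T W' St hW'1 hW'2 hε hrE hs k (hTk k) (hEin' k) (hEout k) (hSin k) (hSout k) (hE k) (hE' k) (hDE k)) hq

end Glue

end Summit.QuantumFields.YangMills.BalabanUVNodes.N15.Gluing

end
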